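import Summits.ResolutionOfSingularities.ResolutionOfSingularities.Theorems.FrobeniusLadderFRationalResolutionMaximalIdealTower
import Summits.ResolutionOfSingularities.ResolutionOfSingularities.Theorems.FrobeniusLadderFRationalResolutionCompletionOfFlatUnramifiedAtPrime
import Summits.ResolutionOfSingularities.ResolutionOfSingularities.Theorems.FrobeniusLadderFRationalResolutionPointBlowupOfCompletion
import HarnessLib

/-!
# Crux `FrobeniusLadder.FRationalResolution` (stmt-ResolutionOfSingularities-15317), line `redirect`,
# stub `stub_diagonalizableQuotientResolution` — VERTEX CLASSES READ ON THE CHART: a twisted isolated point is settled as soon as the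
# blowing up of the maximal ideal of the LOCAL RING OF THE RESIDUE-TRIVIAL CHART is regular (no completion, no cover, no class group in the statement)

`…MaximalIdealTower.hloc_of_isRegular_affineBlowup_maximalIdealPow` (p839495) asks for `Bl_{𝔪̂}(Spec Ê)` regular, `Ê = ((B ⊗_K K')_{𝔔'})^`. With the
completion isomorphism `Ê ≅ (C'_𝔚)^` of `…CompletionOfFlatUnramifiedAtPrime` (p839250) at a flat, unramified, residue-trivial chart point `𝔚 ⊆ C'` (the data of
`…GaloisUpstairsPieceCover.exists_piece_cover`) and the G-ring ascent `C'_𝔚 → (C'_𝔚)^` (p838626, `C'` of finite type over a field), the hypothesis becomes a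
statement about the chart ring alone:

★★ `hloc_of_isRegular_affineBlowup_chart` — Galois data of p838347 + a flat `B ⊗_K K'`-algebra `C'` of finite type over a field `k`, a maximal `𝔚 ⊆ C'` over `𝔔'`
with `𝔔' C'_𝔚 = 𝔚 C'_𝔚` and `∀ x, ∃ b', x − b' ∈ 𝔚`, and **`Bl_{𝔚 C'_𝔚}(Spec C'_𝔚)` regular** ⇒ `hloc` at the twisted point.

By the fan probe of this generation (HOME/leafhand-res-frobeniusladder-2-g17/probe/naive_r2_19.txt; normalized blow-up of the vertex of `1/r(1,a,b)`, `𝔪` a normal ideal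
in all cases) the last hypothesis holds for 59 of the 265 isolated classes with `r ≤ 19` (all `1/r(1,1,1)` and e.g. `1/3(1,1,2)`, `1/7(1,2,4)`, `1/11(1,2,4)`) — for those
twisted points nothing but the toric chart computation is left. Honest label: plumbing toward ONE leaf stub (no stub, crux or summit closed). No definitions, no named
facts, no sorry. [cite: Matsumura1987, Thm. 8.11; Thm. 8.14; §32 p. 256] [cite: StacksProject, Tag 0CDQ; Tag 09EB; Tag 0C4G]
-/

noncomputable section

-- single-problem summit: the doubled namespace component is forced
set_option linter.dupNamespace false

open CategoryTheory CategoryTheory.Limits AlgebraicGeometry TopologicalSpace TensorProduct IsLocalRing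
open Literature.AlgebraicGeometry.Resolution
open Summit.ResolutionOfSingularities.ResolutionOfSingularities.Theorems.FRationalResolution

namespace Summit.ResolutionOfSingularities.ResolutionOfSingularities.Theorems.FRationalResolution.VertexClassFromChart

/-- **Regularity of `Bl_𝔪` passes from the chart's local ring to `Ê`.** `C'` flat over `B'` and of finite type over a field `k`, `𝔚` maximal over the prime
`𝔔'`, unramified and residue-trivial; if `Bl_{𝔚 C'_𝔚}(Spec C'_𝔚)` is regular then `Bl_{𝔔'Ê}(Spec Ê)` is regular, `Ê = (B'_{𝔔'})^`.
[cite: Matsumura1987, Thm. 8.14; §32 p. 256] [cite: StacksProject, Tag 0C4G] -/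
theorem isRegular_affineBlowup_maximalIdeal_adicCompletion_of_chart (k : Type) [Field k] {B' C' : Type} [CommRing B'] [CommRing C']
    [Algebra B' C'] [Module.Flat B' C'] [Algebra k C'] [Algebra.FiniteType k C'] [IsNoetherianRing B']
    (𝔔' : Ideal B') [𝔔'.IsPrime] (𝔚 : Ideal C') [h𝔚 : 𝔚.IsMaximal] (h𝔚B : 𝔚.comap (algebraMap B' C') = 𝔔')
    (hunr : 𝔔'.map (algebraMap B' (Localization.AtPrime 𝔚)) = maximalIdeal (Localization.AtPrime 𝔚))
    (hres : ∀ x : C', ∃ b' : B', x - algebraMap B' C' b' ∈ 𝔚)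
    (hreg : Scheme.IsRegular (affineBlowup (𝔚.map (algebraMap C' (Localization.AtPrime 𝔚))))) :
    Scheme.IsRegular (affineBlowup (𝔔'.map (algebraMap B'
      (AdicCompletion (maximalIdeal (Localization.AtPrime 𝔔')) (Localization.AtPrime 𝔔'))))) := by
  have hC : IsGRing C' := Matsumura1987_32_6_cor_holds.{0} k C' ‹_›
  haveI : IsNoetherianRing C' := hC.1
  haveI : IsNoetherianRing (Localization.AtPrime 𝔚) :=
    IsLocalization.isNoetherianRing 𝔚.primeCompl (Localization.AtPrime 𝔚) inferInstance
  haveI : IsNoetherianRing (Localization.AtPrime 𝔔') :=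
    IsLocalization.isNoetherianRing 𝔔'.primeCompl (Localization.AtPrime 𝔔') inferInstance
  -- ascent `C'_𝔚 → (C'_𝔚)^`
  have h1 := BlowupRegularCompletionAscent.isRegular_affineBlowup_adicCompletion_of_isGRing hC 𝔚 𝔚 hreg
  rw [Localization.AtPrime.map_eq_maximalIdeal, ← AdicCompletion.maximalIdeal_eq_map] at h1
  -- transport along `(C'_𝔚)^ ≅ Ê`
  obtain ⟨e, -⟩ := CompletionOfFlatUnramifiedAtPrime.exists_ringEquiv_adicCompletion_localRingHom 𝔔' 𝔚 h𝔚B hunr hres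
  have h2 := BlowupOrbitCentre.isRegular_affineBlowup_map_of_ringEquiv e.symm _ h1
  rw [PointBlowupOfCompletion.map_maximalIdeal_ringEquiv e.symm, AdicCompletion.maximalIdeal_eq_map] at h2
  have hfac : (algebraMap (Localization.AtPrime 𝔔') (AdicCompletion (maximalIdeal (Localization.AtPrime 𝔔')) (Localization.AtPrime 𝔔'))).comp
      (algebraMap B' (Localization.AtPrime 𝔔')) =
      algebraMap B' (AdicCompletion (maximalIdeal (Localization.AtPrime 𝔔')) (Localization.AtPrime 𝔔')) :=
    RingHom.ext fun _ => rfl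
  rw [← hfac, ← Ideal.map_map, Localization.AtPrime.map_eq_maximalIdeal]
  exact h2

/-- ★★ **VERTEX CLASSES READ ON THE CHART.** Data as in `…GaloisCharacteristicCentre.hloc_of_characteristic_ideal_adicCompletion` (p838347) together with a
residue-trivial flat unramified chart point (`C'`, `𝔚`) of finite type over a field; if `Bl_{𝔚 C'_𝔚}(Spec C'_𝔚)` is regular then `hloc` holds at the twisted point.
[cite: Matsumura1987, Thm. 8.11; Thm. 8.14; §32 p. 256] [cite: StacksProject, Tag 0CDQ; Tag 09EB; Tag 0C4G] -/
theorem hloc_of_isRegular_affineBlowup_chart (K : Type) [Field K] (X : Scheme.{0}) [IsIntegral X]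
    (f : X ⟶ Spec (.of K)) [LocallyOfFiniteType f]
    {B : Type} [CommRing B] [IsDomain B] [Algebra K B] [Algebra.FiniteType K B]
    (ι : Spec (.of B) ⟶ X) [IsOpenImmersion ι] (hι : ι ≫ f = Spec.map (CommRingCat.ofHom (algebraMap K B)))
    (𝔭 : Ideal B) [h𝔭 : 𝔭.IsMaximal] (h𝔭0 : 𝔭 ≠ ⊥)
    (hsing : ι ⟨𝔭, h𝔭.isPrime⟩ ∉ Scheme.regularLocus X)
    (hregB : ∀ P : Spec (.of B), P.asIdeal ≠ 𝔭 → P ∈ Scheme.regularLocus (Spec (.of B)))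
    (K' : Type) [Field K'] [Algebra K K'] [FiniteDimensional K K'] [IsGalois K K']
    (𝔔' : Ideal (B ⊗[K] K')) [h𝔔' : 𝔔'.IsMaximal] (h𝔔'𝔭 : 𝔔'.comap (algebraMap B (B ⊗[K] K')) = 𝔭)
    (k : Type) [Field k] {C' : Type} [CommRing C'] [Algebra (B ⊗[K] K') C'] [Module.Flat (B ⊗[K] K') C'] [Algebra k C']
    [Algebra.FiniteType k C'] (𝔚 : Ideal C') [h𝔚 : 𝔚.IsMaximal] (h𝔚B : 𝔚.comap (algebraMap (B ⊗[K] K') C') = 𝔔')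
    (hunr : 𝔔'.map (algebraMap (B ⊗[K] K') (Localization.AtPrime 𝔚)) = maximalIdeal (Localization.AtPrime 𝔚))
    (hres : ∀ x : C', ∃ b' : B ⊗[K] K', x - algebraMap (B ⊗[K] K') C' b' ∈ 𝔚)
    (hreg : Scheme.IsRegular (affineBlowup (𝔚.map (algebraMap C' (Localization.AtPrime 𝔚))))) :
    ∃ (V : X.Opens), ι ⟨𝔭, h𝔭.isPrime⟩ ∈ V ∧
      (∀ t : X, t ∉ Scheme.regularLocus X → t ∈ V → t = ι ⟨𝔭, h𝔭.isPrime⟩) ∧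
      ∃ (Y : Scheme.{0}) (ρ : Y ⟶ V), IsProper ρ ∧ Scheme.IsRegular Y ∧
        IsIso (ρ ∣_ (V.ι ⁻¹ᵁ ⟨Scheme.regularLocus X, isOpen_regularLocus_of_locallyOfFiniteType_field f⟩)) ∧
        Dense ((ρ ⁻¹ᵁ (V.ι ⁻¹ᵁ ⟨Scheme.regularLocus X,
          isOpen_regularLocus_of_locallyOfFiniteType_field f⟩) : Y.Opens) : Set Y) := by
  haveI : IsNoetherianRing B := Algebra.FiniteType.isNoetherianRing K B
  haveI : Algebra.FiniteType B (B ⊗[K] K') := inferInstance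
  haveI : IsNoetherianRing (B ⊗[K] K') := Algebra.FiniteType.isNoetherianRing B (B ⊗[K] K')
  have h := isRegular_affineBlowup_maximalIdeal_adicCompletion_of_chart k 𝔔' 𝔚 h𝔚B hunr hres hreg
  rw [← pow_one (𝔔'.map _)] at h
  exact MaximalIdealTower.hloc_of_isRegular_affineBlowup_maximalIdealPow K X f ι hι 𝔭 h𝔭0 hsing hregB K' 𝔔' h𝔔'𝔭 0 h

end Summit.ResolutionOfSingularities.ResolutionOfSingularities.Theorems.FRationalResolution.VertexClassFromChart

end
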